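import Mathlib
import HarnessLib

/-!
# ValiantsHypothesis / SymPencil — crux `EquivariantSdcNotQP` (stmt-ValiantsHypothesis-17792), line
# `birth_EquivariantSdcNotQP`, open piece (iii′) `PermEmbeddingQP` of `stub_permify`: FINITENESS of the
# lift group and the BRIDGE to the abstract finite-group form (iii″)

After `…FiniteConjugationLift.lean` / `…PermifyOfPermEmbedding.lean` the registered stub `stub_permify`
rests on the single hypothesis (iii′) `PermEmbeddingQP` (text: «Open pieces» of
`…PermifyReduction.lean`), quantified over subgroups `F ≤ (𝔖_n × 𝔖_n) × GL_{m₀}(ℂ)` lying over every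
`(π, ρ)` with scalar unimodular fibre over `(1,1)`.  This file (helper of the item,
`--supports stmt-ValiantsHypothesis-17792 --as helper`; 0 definitions / 0 named facts) proves:
* `finite_of_scalar_unimodular_fibre` — such an `F` is FINITE (the fibre embeds into the `m₀`-th
  roots of unity; the base `𝔖_n × 𝔖_n` is finite; `MonoidHom.finite_iff_finite_ker_range`);
* `permEmbeddingQP_of_abstract` — **(iii′) ⇐ (iii″)**, where (iii″) is the same embedding statement
  for an ABSTRACT finite group `G` with a surjection `φ : G →* 𝔖_n × 𝔖_n` and a representation
  `ρ : G →* GL_{m₀}(ℂ)` whose restriction to `ker φ` is scalar and unimodular — the currency in which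
  a `Representation`-based proof of the core (Young's rule and Specht/spin degree bounds for
  `𝔖_n × 𝔖_n`, e.g. on the tree's `Literature/NumberTheory/DiophantineGeometry/SymmetricGroupReps*`
  layer) would naturally be written.

Honest framing: neither result discharges (iii′); `stub_permify`, the crux `SymPencil.EquivariantSdcNotQP`
and `VP ≠ VNP` remain OPEN and nothing here is progress on them.
-/

noncomputable section

set_option linter.dupNamespace false

namespace Summit.ValiantsHypothesis.ValiantsHypothesis.Theorems.SymPencilEquivariantSdcNotQP

open Matrix

/-- **The lift group is finite.**  A subgroup of `(𝔖_n × 𝔖_n) × GL_{m₀}(ℂ)` whose fibre over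
`(1, 1)` consists of scalar matrices and all of whose matrices are unimodular is finite: the fibre
embeds into the `m₀`-th roots of unity. [folklore] -/
theorem finite_of_scalar_unimodular_fibre {n m₀ : ℕ}
    (F : Subgroup ((Equiv.Perm (Fin n) × Equiv.Perm (Fin n)) × GL (Fin m₀) ℂ))
    (hscal : ∀ g : GL (Fin m₀) ℂ, ((1 : Equiv.Perm (Fin n) × Equiv.Perm (Fin n)), g) ∈ F →
      ∃ c : ℂ, (g : Matrix (Fin m₀) (Fin m₀) ℂ) = c • (1 : Matrix (Fin m₀) (Fin m₀) ℂ))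
    (hdet : ∀ x ∈ F, Matrix.det (x.2 : Matrix (Fin m₀) (Fin m₀) ℂ) = 1) : Finite F := by
  classical
  set f : F →* Equiv.Perm (Fin n) × Equiv.Perm (Fin n) :=
    (MonoidHom.fst _ _).comp F.subtype with hf
  rw [MonoidHom.finite_iff_finite_ker_range f]
  refine ⟨?_, inferInstance⟩
  rcases Nat.eq_zero_or_pos m₀ with hm | hm
  · -- `m₀ = 0`: the matrix factor is trivial, so the kernel embeds into a point
    subst hm
    refine Finite.of_injective (fun _ : f.ker => (0 : Fin 1)) ?_
    intro x y _
    apply Subtype.ext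
    apply Subtype.ext
    have hx : ((x : F) : (Equiv.Perm (Fin n) × Equiv.Perm (Fin n)) × GL (Fin 0) ℂ).1 = 1 := by
      have := x.2; rwa [MonoidHom.mem_ker] at this
    have hy : ((y : F) : (Equiv.Perm (Fin n) × Equiv.Perm (Fin n)) × GL (Fin 0) ℂ).1 = 1 := by
      have := y.2; rwa [MonoidHom.mem_ker] at this
    refine Prod.ext (hx.trans hy.symm) (Units.ext (Matrix.ext fun i => Fin.elim0 i))
  · -- `m₀ ≥ 1`: kernel elements are `((1,1), c • 1)` with `c^{m₀} = 1`
    let i₀ : Fin m₀ := ⟨0, hm⟩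
    have hker : ∀ x : f.ker, ((x : F) : (Equiv.Perm (Fin n) × Equiv.Perm (Fin n)) × GL (Fin m₀) ℂ).1 = 1 :=
      fun x => by have := x.2; rwa [MonoidHom.mem_ker] at this
    have hsc : ∀ x : f.ker, ∃ c : ℂ,
        ((((x : F) : (Equiv.Perm (Fin n) × Equiv.Perm (Fin n)) × GL (Fin m₀) ℂ).2 :
          Matrix (Fin m₀) (Fin m₀) ℂ)) = c • (1 : Matrix (Fin m₀) (Fin m₀) ℂ) := by
      intro x
      apply hscal
      have hmem := (x : F).2
      have heq : ((x : F) : (Equiv.Perm (Fin n) × Equiv.Perm (Fin n)) × GL (Fin m₀) ℂ) =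
          ((1 : Equiv.Perm (Fin n) × Equiv.Perm (Fin n)),
            ((x : F) : (Equiv.Perm (Fin n) × Equiv.Perm (Fin n)) × GL (Fin m₀) ℂ).2) :=
        Prod.ext (hker x) rfl
      rw [← heq]
      exact hmem
    refine Finite.of_injective (fun x : f.ker =>
      (⟨((((x : F) : (Equiv.Perm (Fin n) × Equiv.Perm (Fin n)) × GL (Fin m₀) ℂ).2 :
          Matrix (Fin m₀) (Fin m₀) ℂ)) i₀ i₀, ?_⟩ :
        {c : ℂ // c ∈ Polynomial.nthRootsFinset m₀ (1 : ℂ)})) ?_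
    · obtain ⟨c, hc⟩ := hsc x
      rw [Polynomial.mem_nthRootsFinset hm, hc]
      have hd := hdet _ (x : F).2
      rw [hc, Matrix.det_smul, Matrix.det_one, mul_one, Fintype.card_fin] at hd
      simpa using hd
    · intro x y hxy
      simp only [Subtype.mk.injEq] at hxy
      obtain ⟨c, hc⟩ := hsc x
      obtain ⟨c', hc'⟩ := hsc y
      have hcc : c = c' := by
        have h1 : ((((x : F) : (Equiv.Perm (Fin n) × Equiv.Perm (Fin n)) × GL (Fin m₀) ℂ).2 :
          Matrix (Fin m₀) (Fin m₀) ℂ)) i₀ i₀ = c := by rw [hc]; simp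
        have h2 : ((((y : F) : (Equiv.Perm (Fin n) × Equiv.Perm (Fin n)) × GL (Fin m₀) ℂ).2 :
          Matrix (Fin m₀) (Fin m₀) ℂ)) i₀ i₀ = c' := by rw [hc']; simp
        rw [← h1, ← h2, hxy]
      apply Subtype.ext
      apply Subtype.ext
      refine Prod.ext ((hker x).trans (hker y).symm) (Units.ext ?_)
      rw [hc, hc', hcc]

/-- **(iii′) ⇐ (iii″): the abstract finite-group form of the permutation embedding suffices.**
If every finite group `G` with a surjection `φ` onto `𝔖_n × 𝔖_n` and a representation
`ρ : G →* GL_{m₀}(ℂ)`, scalar and unimodular on `ker φ`, makes `ℂ^{m₀}` an equivariant retract of a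
permutation `G`-set of size `≤ 2^{(log₂ m₀ + log₂ n + d)^d}`, then (iii′) `PermEmbeddingQP` holds
(take `G = F`, `φ = pr₁`, `ρ = pr₂`; `F` is finite by `finite_of_scalar_unimodular_fibre`). [folklore] -/
theorem permEmbeddingQP_of_abstract
    (h : ∃ d : ℕ, ∀ (n m₀ : ℕ) (G : Type) [Group G] [Finite G]
      (φ : G →* Equiv.Perm (Fin n) × Equiv.Perm (Fin n)) (ρ : G →* GL (Fin m₀) ℂ),
      Function.Surjective φ →
      (∀ g : G, φ g = 1 → ∃ c : ℂ, (ρ g : Matrix (Fin m₀) (Fin m₀) ℂ) = c • (1 : Matrix (Fin m₀) (Fin m₀) ℂ)) →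
      (∀ g : G, Matrix.det (ρ g : Matrix (Fin m₀) (Fin m₀) ℂ) = 1) →
      ∃ m' ≤ 2 ^ ((Nat.log 2 m₀ + Nat.log 2 n + d) ^ d),
        ∃ (ι : Matrix (Fin m') (Fin m₀) ℂ) (p : Matrix (Fin m₀) (Fin m') ℂ) (τ : G → Equiv.Perm (Fin m')),
          p * ι = 1 ∧ ∀ g : G,
            (τ g).permMatrix ℂ * ι = ι * (ρ g : Matrix (Fin m₀) (Fin m₀) ℂ) ∧
            p * (τ g).permMatrix ℂ = (ρ g : Matrix (Fin m₀) (Fin m₀) ℂ) * p) :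
    ∃ d : ℕ, ∀ (n m₀ : ℕ)
      (F : Subgroup ((Equiv.Perm (Fin n) × Equiv.Perm (Fin n)) × GL (Fin m₀) ℂ)),
      (∀ π ρ : Equiv.Perm (Fin n), ∃ g : GL (Fin m₀) ℂ, ((π, ρ), g) ∈ F) →
      (∀ g : GL (Fin m₀) ℂ, ((1 : Equiv.Perm (Fin n) × Equiv.Perm (Fin n)), g) ∈ F →
        ∃ c : ℂ, (g : Matrix (Fin m₀) (Fin m₀) ℂ) = c • (1 : Matrix (Fin m₀) (Fin m₀) ℂ)) →
      (∀ x ∈ F, Matrix.det (x.2 : Matrix (Fin m₀) (Fin m₀) ℂ) = 1) →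
      ∃ m' ≤ 2 ^ ((Nat.log 2 m₀ + Nat.log 2 n + d) ^ d),
        ∃ (ι : Matrix (Fin m') (Fin m₀) ℂ) (p : Matrix (Fin m₀) (Fin m') ℂ)
          (τ : (Equiv.Perm (Fin n) × Equiv.Perm (Fin n)) × GL (Fin m₀) ℂ → Equiv.Perm (Fin m')),
          p * ι = 1 ∧ ∀ x ∈ F,
            (τ x).permMatrix ℂ * ι = ι * (x.2 : Matrix (Fin m₀) (Fin m₀) ℂ) ∧
            p * (τ x).permMatrix ℂ = (x.2 : Matrix (Fin m₀) (Fin m₀) ℂ) * p := by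
  classical
  obtain ⟨d, hd⟩ := h
  refine ⟨d, fun n m₀ F hsurj hscal hdet => ?_⟩
  haveI : Finite F := finite_of_scalar_unimodular_fibre F hscal hdet
  set φ : F →* Equiv.Perm (Fin n) × Equiv.Perm (Fin n) := (MonoidHom.fst _ _).comp F.subtype with hφ
  set ρ : F →* GL (Fin m₀) ℂ := (MonoidHom.snd _ _).comp F.subtype with hρ
  have hφs : Function.Surjective φ := by
    rintro ⟨π, σ⟩
    obtain ⟨g, hg⟩ := hsurj π σ
    exact ⟨⟨((π, σ), g), hg⟩, rfl⟩
  have hker : ∀ g : F, φ g = 1 →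
      ∃ c : ℂ, (ρ g : Matrix (Fin m₀) (Fin m₀) ℂ) = c • (1 : Matrix (Fin m₀) (Fin m₀) ℂ) := by
    intro g hg
    apply hscal
    have heq : ((g : (Equiv.Perm (Fin n) × Equiv.Perm (Fin n)) × GL (Fin m₀) ℂ)) =
        ((1 : Equiv.Perm (Fin n) × Equiv.Perm (Fin n)), ρ g) := Prod.ext hg rfl
    rw [← heq]
    exact g.2
  have hdet' : ∀ g : F, Matrix.det (ρ g : Matrix (Fin m₀) (Fin m₀) ℂ) = 1 := fun g => hdet _ g.2
  obtain ⟨m', hm', ι, p, τ, hpι, hrel⟩ := hd n m₀ F φ ρ hφs hker hdet'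
  refine ⟨m', hm', ι, p, fun x => if hx : x ∈ F then τ ⟨x, hx⟩ else 1, hpι, fun x hx => ?_⟩
  simp only [dif_pos hx]
  exact hrel ⟨x, hx⟩

end Summit.ValiantsHypothesis.ValiantsHypothesis.Theorems.SymPencilEquivariantSdcNotQP

end
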